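import Literature.Probability.LatticeModels.HIncrementLimit
import Literature.Probability.LatticeModels.LatticeToContinuumLimit
import HarnessLib

/-!
# Increments of a lattice primitive converge to `-κ Im (θ₀² ∫ g²)`, for an abstract family

Topic `Literature/Probability/LatticeModels`; the observable-independent form of
`HIncrementLimit.lean` (`tendsto_hw_staircase_core`; Smirnov 2010 §5: "`H_δ = Im ∫^δ F_δ²`
converges to `Im ∫ f²`"), for the spin fermion of Chelkak–Hongler–Izyurov 2015 (§3.5: "`H_δ → h̃ :=
Re ∫ f̃²` uniformly on compact subsets") whose white increment formula is
`Hw(x + e_k) - Hw(x) = -(1/(√2 c_KC)) Im(i^k F(e_k)²)` (`KCObservableFlux.cornerFlux_kcObs` with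
`SpinorIncrements.cornerFlux_sub_cornerFlux_eq_im_of_relAt`). Hypotheses: along the sequence of
meshes, site functions `Hw_k` whose increments across the horizontal and vertical edges at sites
with mesh point in `K` are `-κ Im(i^e (θ₀ F_k(e))²)` for fixed constants `κ`, `θ₀`; the static
estimates (cross bound, `√δ` sup bound) and `δ^{-1/2}F → g` uniformly on `K`. Conclusion: the
increment of `Hw_k` along the lattice staircase in a rectangle with ordered corners converges to
`-κ Im(θ₀² (∫ g²(x + i z.im) dx + i ∫ g²(w.re + i y) dy))`. The Riemann-sum argument is the tree's
verbatim. Everything is proved; no named fact.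

## References

* S. Smirnov, Ann. of Math. 172 (2010), Remark 3.7 and §5 [Smirnov2010].
* D. Chelkak, C. Hongler, K. Izyurov, Ann. of Math. 181 (2015), §3.5 [ChelkakHonglerIzyurovAnnals2015].
-/

noncomputable section

namespace Literature.Probability.LatticeModels

open Filter _root_.Topology Metric Set Finset Complex

/-- **Staircase increments of a lattice primitive converge to `-κ Im(θ₀² ∫ g²)`** (generic family;
ordered corners; static hypotheses from the start). [cite: Smirnov2010, Remark 3.7 and §5; ChelkakHonglerIzyurovAnnals2015, §3.5] -/
theorem tendsto_staircase_of_increments {Fm : ℝ → MedialVertex → ℂ} {s : ℕ → ℝ} (hs0 : ∀ k, 0 < s k)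
    (hs : Tendsto s atTop (𝓝 0)) {g : ℂ → ℂ} {z w : ℂ} (hre : z.re ≤ w.re) (him : z.im ≤ w.im)
    {K : Set ℂ} (hK : IsCompact K) (hg : ContinuousOn g K) {r : ℝ} (hr : 0 < r)
    (hKR : cthickening r (Rectangle z w) ⊆ K)
    (hconv : TendstoUniformlyOn (scaledEdgeFamily Fm s) g atTop K) (hsr : ∀ k, 3 * s k ≤ r)
    {L : ℝ} (hcross : ∀ k, ∀ x : Site 2, meshPoint (s k) x ∈ K →
      ‖Fm (s k) (cSrc (x, 1)) - Fm (s k) (cSrc (x, 0))‖ ≤ L * s k * Real.sqrt (s k))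
    {M : ℝ} (hM : ∀ k, ∀ x : Site 2, meshPoint (s k) x ∈ K → ∀ i : Fin 4, (i = 0 ∨ i = 1) →
      ‖Fm (s k) (cSrc (x, i))‖ ≤ M * Real.sqrt (s k))
    (Hw : ℕ → Site 2 → ℝ) {κ : ℝ} {θ₀ : ℂ}
    (hincr : ∀ k, ∀ y : Site 2, meshPoint (s k) y ∈ K → ∀ e : Fin 4,
      Hw k (y + cornerUnit e) - Hw k y = -κ * (I ^ (e : ℕ) * (θ₀ * Fm (s k) (cSrc (y, e))) ^ 2).im) :
    Tendsto (fun k => Hw k (vtx (nearestSite (s k) z) (⌊(w.re - z.re) / s k⌋₊) (⌊(w.im - z.im) / s k⌋₊)) -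
        Hw k (nearestSite (s k) z)) atTop
      (𝓝 (-κ * (θ₀ ^ 2 * ((∫ x : ℝ in z.re..w.re, g (x + z.im * I) ^ 2) +
          I * ∫ y : ℝ in z.im..w.im, g (w.re + y * I) ^ 2)).im)) := by
  -- notation
  set b : ℕ → Site 2 := fun k => nearestSite (s k) z with hb
  set m : ℕ → ℕ := fun k => ⌊(w.re - z.re) / s k⌋₊ with hm
  set n : ℕ → ℕ := fun k => ⌊(w.im - z.im) / s k⌋₊ with hn
  set F : ∀ k : ℕ, MedialVertex → ℂ := fun k => Fm (s k) with hF
  set u := scaledEdgeFamily Fm s with hu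
  have hfloorx : ∀ k, (m k : ℝ) * s k ≤ w.re - z.re ∧ w.re - z.re < (m k + 1) * s k :=
    fun k => floor_mul_le_of_le (by linarith) (hs0 k)
  have hfloory : ∀ k, (n k : ℝ) * s k ≤ w.im - z.im ∧ w.im - z.im < (n k + 1) * s k :=
    fun k => floor_mul_le_of_le (by linarith) (hs0 k)
  -- grid points are in `K`, edges near them interior
  have hgridK : ∀ k (i j : ℤ), -1 ≤ i → i ≤ m k + 1 → -1 ≤ j → j ≤ n k + 1 → meshPoint (s k) (vtx (b k) i j) ∈ K := by
    intro k i j hi hi' hj hj'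
    exact hKR (cthickening_mono (hsr k) _ (meshPoint_vtx_mem_cthickening (hs0 k) z w hre him hi hi' hj hj'))
  have hhor : ∀ k (x : Site 2), F k (cSrc (x, 0)) = (Real.sqrt (s k) : ℂ) * u k (meshPoint (s k) x) := by
    intro k x
    have hsq' : (Real.sqrt (s k) : ℂ) ≠ 0 := by exact_mod_cast (Real.sqrt_pos.2 (hs0 k)).ne'
    simp only [hu, hF, scaledEdgeFamily, nearestSite_meshPoint (hs0 k).ne', ← mul_assoc, mul_inv_cancel₀ hsq', one_mul]
  have hsq : ∀ k, ((Real.sqrt (s k) : ℂ)) ^ 2 = (s k : ℂ) := fun k => by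
    rw [← Complex.ofReal_pow, Real.sq_sqrt (hs0 k).le]
  -- telescoping along the horizontal leg `(t, 0)`, `t < m`, and the vertical leg `(m, t)`, `t < n`
  have htel : ∀ k, Hw k (vtx (b k) (m k) (n k)) - Hw k (b k) =
      ∑ t ∈ Finset.range (m k), (Hw k (vtx (b k) ((t : ℤ) + 1) 0) - Hw k (vtx (b k) t 0)) +
        ∑ t ∈ Finset.range (n k), (Hw k (vtx (b k) (m k) ((t : ℤ) + 1)) - Hw k (vtx (b k) (m k) t)) := by
    intro k
    have h1 := Finset.sum_range_sub (fun t : ℕ => Hw k (vtx (b k) t 0)) (m k)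
    have h2 := Finset.sum_range_sub (fun t : ℕ => Hw k (vtx (b k) (m k) t)) (n k)
    simp only [Nat.cast_succ, Nat.cast_zero] at h1 h2
    rw [h1, h2, vtx_zero_zero]
    ring
  -- horizontal leg in terms of `u`
  have hlegH : ∀ k, ∑ t ∈ Finset.range (m k), (Hw k (vtx (b k) ((t : ℤ) + 1) 0) - Hw k (vtx (b k) t 0)) =
      -κ * (θ₀ ^ 2 * ((s k : ℂ) * ∑ t ∈ Finset.range (m k), u k (meshPoint (s k) (vtx (b k) t 0)) ^ 2)).im := by
    intro k
    have hterm : ∀ t ∈ Finset.range (m k), Hw k (vtx (b k) ((t : ℤ) + 1) 0) - Hw k (vtx (b k) t 0) =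
        -κ * (θ₀ ^ 2 * ((s k : ℂ) * u k (meshPoint (s k) (vtx (b k) t 0)) ^ 2)).im := by
      intro t ht
      have htm := Finset.mem_range.1 ht
      rw [vtx_add_one_left, hincr k _ (hgridK k t 0 (by omega) (by omega) (by omega) (by omega)) 0]
      have e : I ^ ((0 : Fin 4) : ℕ) * (θ₀ * F k (cSrc (vtx (b k) t 0, 0))) ^ 2 =
          θ₀ ^ 2 * ((s k : ℂ) * u k (meshPoint (s k) (vtx (b k) t 0)) ^ 2) := by
        rw [Fin.val_zero, pow_zero, one_mul, mul_pow, hhor, mul_pow, hsq]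
      rw [e]
    rw [Finset.sum_congr rfl hterm, ← Finset.mul_sum]
    congr 1
    rw [← Complex.im_sum]
    congr 1
    rw [Finset.mul_sum, Finset.mul_sum]
  -- vertical leg in terms of `u` plus an error
  set err : ℕ → ℂ := fun k => ∑ t ∈ Finset.range (n k),
    (F k (cSrc (vtx (b k) (m k) t, 1)) ^ 2 - F k (cSrc (vtx (b k) (m k) t, 0)) ^ 2) with herr
  have hlegV : ∀ k, ∑ t ∈ Finset.range (n k), (Hw k (vtx (b k) (m k) ((t : ℤ) + 1)) - Hw k (vtx (b k) (m k) t)) =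
      -κ * (I * θ₀ ^ 2 * ((s k : ℂ) * ∑ t ∈ Finset.range (n k), u k (meshPoint (s k) (vtx (b k) (m k) t)) ^ 2 + err k)).im := by
    intro k
    have hterm : ∀ t ∈ Finset.range (n k), Hw k (vtx (b k) (m k) ((t : ℤ) + 1)) - Hw k (vtx (b k) (m k) t) =
        -κ * (I * θ₀ ^ 2 * F k (cSrc (vtx (b k) (m k) t, 1)) ^ 2).im := by
      intro t ht
      have htn := Finset.mem_range.1 ht
      rw [vtx_add_one_right, hincr k _ (hgridK k (m k) t (by omega) (by omega) (by omega) (by omega)) 1]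
      have e : I ^ ((1 : Fin 4) : ℕ) * (θ₀ * F k (cSrc (vtx (b k) (m k) t, 1))) ^ 2 =
          I * θ₀ ^ 2 * F k (cSrc (vtx (b k) (m k) t, 1)) ^ 2 := by
        rw [Fin.val_one, pow_one]; ring
      rw [e]
    rw [Finset.sum_congr rfl hterm]
    have e : (s k : ℂ) * ∑ t ∈ Finset.range (n k), u k (meshPoint (s k) (vtx (b k) (m k) t)) ^ 2 + err k =
        ∑ t ∈ Finset.range (n k), F k (cSrc (vtx (b k) (m k) t, 1)) ^ 2 := by
      rw [herr, Finset.mul_sum, ← Finset.sum_add_distrib]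
      refine Finset.sum_congr rfl fun t _ => ?_
      rw [hhor, mul_pow, hsq]; ring
    rw [e, ← Finset.mul_sum]
    congr 1
    rw [← Complex.im_sum]
    congr 1
    rw [Finset.mul_sum]
  -- uniform convergence of `u²` to `g²`
  obtain ⟨Mg, hMg⟩ := hK.exists_bound_of_continuousOn hg
  have hconv2 : TendstoUniformlyOn (fun k ζ => u k ζ ^ 2) (fun ζ => g ζ ^ 2) atTop K := TendstoUniformlyOn.pow_two hconv hMg
  have hg2 : ContinuousOn (fun ζ => g ζ ^ 2) K := hg.pow 2
  -- limits of the two Riemann sums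
  have LH : Tendsto (fun k => (s k : ℂ) * ∑ t ∈ Finset.range (m k), u k (meshPoint (s k) (vtx (b k) t 0)) ^ 2) atTop
      (𝓝 (∫ x : ℝ in z.re..w.re, g (x + z.im * I) ^ 2)) := by
    have := tendsto_row_sum hK hg2 hconv2 hs0 hs hre him hr hKR hsr m (fun _ => 0) z.im ⟨le_rfl, him⟩
      (fun k => Or.inl rfl) (fun k => ⟨by omega, by omega⟩) (fun k => by simp [(hs0 k).le])
    simpa using this
  have LV : Tendsto (fun k => (s k : ℂ) * ∑ t ∈ Finset.range (n k), u k (meshPoint (s k) (vtx (b k) (m k) t)) ^ 2) atTop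
      (𝓝 (∫ y : ℝ in z.im..w.im, g (w.re + y * I) ^ 2)) := by
    have := tendsto_col_sum hK hg2 hconv2 hs0 hs hre him hr hKR hsr n (fun k => m k) w.re ⟨hre, le_rfl⟩
      (fun k => Or.inl rfl) (fun k => ⟨by omega, by simp only [hm]; omega⟩)
      (fun k => by have h' := hfloorx k; simp only [hm] at h' ⊢; rw [abs_le]; push_cast; constructor <;> nlinarith [h'.1, h'.2])
    simpa using this
  -- the error tends to zero: `‖err k‖ ≤ n · (L s √s) (2 M √s) = 2 L M (n s) s`
  have Lerr : Tendsto err atTop (𝓝 0) := by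
    rw [tendsto_zero_iff_norm_tendsto_zero]
    have hbound : ∀ k, ‖err k‖ ≤ 2 * (|L| * |M|) * ((n k : ℝ) * s k) * s k := by
      intro k
      have hsk := hs0 k
      have hsq' : Real.sqrt (s k) * Real.sqrt (s k) = s k := Real.mul_self_sqrt hsk.le
      calc ‖err k‖ ≤ ∑ t ∈ Finset.range (n k), ‖F k (cSrc (vtx (b k) (m k) t, 1)) ^ 2 - F k (cSrc (vtx (b k) (m k) t, 0)) ^ 2‖ :=
            norm_sum_le _ _
        _ ≤ ∑ t ∈ Finset.range (n k), (|L| * s k * Real.sqrt (s k)) * (2 * (|M| * Real.sqrt (s k))) := by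
            refine Finset.sum_le_sum fun t ht => ?_
            have htn := Finset.mem_range.1 ht
            have hyK := hgridK k (m k) t (by omega) (by omega) (by omega) (by omega)
            set a := F k (cSrc (vtx (b k) (m k) t, 1))
            set a' := F k (cSrc (vtx (b k) (m k) t, 0))
            have h1 : ‖a - a'‖ ≤ |L| * s k * Real.sqrt (s k) :=
              (hcross k _ hyK).trans (by gcongr; exact le_abs_self L)
            have h2 : ‖a‖ ≤ |M| * Real.sqrt (s k) := (hM k _ hyK 1 (Or.inr rfl)).trans (by gcongr; exact le_abs_self M)
            have h3 : ‖a'‖ ≤ |M| * Real.sqrt (s k) := (hM k _ hyK 0 (Or.inl rfl)).trans (by gcongr; exact le_abs_self M)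
            rw [show a ^ 2 - a' ^ 2 = (a - a') * (a + a') by ring, norm_mul]
            refine mul_le_mul h1 ((norm_add_le _ _).trans (by linarith)) (norm_nonneg _) (by positivity)
        _ = 2 * (|L| * |M|) * ((n k : ℝ) * s k) * s k := by
            rw [Finset.sum_const, Finset.card_range, nsmul_eq_mul]
            calc (n k : ℝ) * (|L| * s k * Real.sqrt (s k) * (2 * (|M| * Real.sqrt (s k))))
                = 2 * (|L| * |M|) * ((n k : ℝ) * s k) * (Real.sqrt (s k) * Real.sqrt (s k)) := by ring
              _ = _ := by rw [hsq']
    have hnN : Tendsto (fun k => (n k : ℝ) * s k) atTop (𝓝 (w.im - z.im)) :=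
      tendsto_floor_mul hs0 hs (ℓ := w.im - z.im) (by linarith) (N := n) fun k => Or.inl rfl
    have hlim : Tendsto (fun k => 2 * (|L| * |M|) * ((n k : ℝ) * s k) * s k) atTop (𝓝 0) := by
      have := (hnN.const_mul (2 * (|L| * |M|))).mul hs
      rw [mul_zero] at this
      exact this
    exact squeeze_zero (fun k => norm_nonneg _) hbound hlim
  -- assemble
  have hmain : Tendsto (fun k => -κ * (θ₀ ^ 2 * ((s k : ℂ) * ∑ t ∈ Finset.range (m k), u k (meshPoint (s k) (vtx (b k) t 0)) ^ 2)).im +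
      -κ * (I * θ₀ ^ 2 * ((s k : ℂ) * ∑ t ∈ Finset.range (n k), u k (meshPoint (s k) (vtx (b k) (m k) t)) ^ 2 + err k)).im) atTop
      (𝓝 (-κ * (θ₀ ^ 2 * ∫ x : ℝ in z.re..w.re, g (x + z.im * I) ^ 2).im +
        -κ * (I * θ₀ ^ 2 * ((∫ y : ℝ in z.im..w.im, g (w.re + y * I) ^ 2) + 0)).im)) := by
    refine Tendsto.add ?_ ?_
    · exact ((Complex.continuous_im.tendsto _).comp (LH.const_mul (θ₀ ^ 2))).const_mul (-κ)
    · exact ((Complex.continuous_im.tendsto _).comp ((LV.add Lerr).const_mul (I * θ₀ ^ 2))).const_mul (-κ)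
  rw [add_zero] at hmain
  have e : -κ * (θ₀ ^ 2 * ∫ x : ℝ in z.re..w.re, g (x + z.im * I) ^ 2).im +
      -κ * (I * θ₀ ^ 2 * ∫ y : ℝ in z.im..w.im, g (w.re + y * I) ^ 2).im =
      -κ * (θ₀ ^ 2 * ((∫ x : ℝ in z.re..w.re, g (x + z.im * I) ^ 2) + I * ∫ y : ℝ in z.im..w.im, g (w.re + y * I) ^ 2)).im := by
    rw [mul_add, Complex.add_im, mul_add, ← mul_assoc, mul_comm (θ₀ ^ 2) I]
  rw [e] at hmain
  refine hmain.congr fun k => ?_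
  rw [htel k, hlegH k, hlegV k]


end Literature.Probability.LatticeModels
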